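import Summits.PneNP.PneNP.Theorems.ChebyshevTracialDesignRungAssemblyAll
import HarnessLib

/-!
# Cell pnp-psdrank, route `ChebyshevTracialDesign`: the spread-cell bound in the REDUCED INSTANCES of the non-tight-free `r = 1` rung,
# complement-symmetric form (cut sizes on either side of `m/2`)

Harmonic backbone of the crux `TracialDecayExp20` (stmt-PneNP-19878), brick 50b (prover g10; NTF mod KL). Supplies the hypothesis `hVNS` of
brick 50a (`…RungAssemblyAll.value_le_three_terms`) from bricks 47 (`spreadCell_value_le_half_of_globalLevelD`), 48b (complement symmetry) and 50a §2
(the uniform bounds `exp 2000` for the attenuation factor and `P* = Π_{i ≤ (D−q)/2}(2i+1)/(n−2q−2i)` for the reduced tails):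
**`reduced_spreadCell_value_le_of_globalLevelD`** — under `GlobalLevelDInequality` there are `c₀ ∈ (0,1]`, `n₀` such that for all `n, q, D, T, B, C`
with odd levels `3 ≤ c ≤ T`, `T² ≤ 49n`, `200T ≤ n`, `40q ≤ n`, `2q ≤ dq n`, `D ≤ dq n`, and every reduced instance `K_m` (`n₀ ≤ m`,
`n ≤ m + 2q`, `m` even; `4 dq n + 8 ≤ n`) with odd cut size `t''`, `m ≤ 5t''`, `m ≤ 5(m−t'')`, `T ≤ t''`, `T ≤ m−t''`, `D'+3 ≤ t''`, `D'+3 ≤ m−t''`, `D ≤ D'+q`,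
`D' ≤ D`, nonempty classes, a reduced design `w'` exact of degree `D'` with `Σ|w'_c| ≤ B`, every family `X` of `t''`-cuts and every
`(PM_m, e)`-homogeneous `Y'`, both of density `≥ exp(−c₀ dq m)`: `Σ_{X × Y'} levelWeight m t'' C w' ≤ B·(exp 2000·√P*)`.
(If `2t'' ≤ m` brick 47 applies directly; otherwise to the complements `[m] ∖ U`, of size `m − t'' < m/2`, which carry the same values
(`sum_levelWeight_compl`), densities (`C(m,t'') = C(m,m−t'')`) and level classes (`card_Qset_compl`).)
[cite: Rothvoss2017, §2 (PDF pp. 5–6)] [cite: KeevashLifshitz2023, Thm. 1.8] [cite: KupavskiiZakharov2022, Lemma 11]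
Stature: support/instrument, CONDITIONAL on `GlobalLevelDInequality` (binder only). WHAT THIS IS NOT: not NTF's final constants (next file),
not the crux, nothing on psd rank, no P-vs-NP content. Supports stmt-PneNP-19878.
-/

set_option linter.dupNamespace false -- `Summit.PneNP.PneNP.…`: summit = sub-problem (D-0017)

noncomputable section

namespace Summit.PneNP.PneNP.Theorems.ChebyshevTracialDesignReducedSpreadCell

open Finset Literature.Combinatorics.Optimization
open Literature.Barriers.PneNP hiding verts
open Literature.Combinatorics.SetFamily
open Literature.Combinatorics.SimpleGraph.CycleSpace
open Literature.Combinatorics.Additive.KeevashLifshitz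
open Summit.PneNP.PneNP.Theorems.ChebyshevTracialDesignProfilePolynomial (card_pmatch_pos)
open Summit.PneNP.PneNP.Theorems.ChebyshevTracialDesignLevelTail (prod_atten_le_of_le atten_factor_le_one)
open Summit.PneNP.PneNP.Theorems.ChebyshevTracialDesignRungConstants (pred_pow_four_add_le)
open Summit.PneNP.PneNP.Theorems.ChebyshevTracialDesignProfileExtrapolationHalf
open Summit.PneNP.PneNP.Theorems.ChebyshevTracialDesignLevelWeightCompl
open Summit.PneNP.PneNP.Theorems.ChebyshevTracialDesignRungCells (card_tcuts_eq_choose)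
open Summit.PneNP.PneNP.Theorems.ChebyshevTracialDesignRungAssemblyAll

variable {n : ℕ}

/-- `dq m ≥ dq n − 1` for `n ≤ m + 2q`, `2q ≤ dq n`. [folklore] -/
theorem dq_pred_le {m q : ℕ} (hmq : n ≤ m + 2 * q) (h2q : 2 * q ≤ dq n) (hD : 1 ≤ dq n) : dq n - 1 ≤ dq m := by
  have hD4n : dq n ^ 4 ≤ n := by
    have h1 : dq n * dq n ≤ Nat.sqrt n := Nat.sqrt_le (Nat.sqrt n)
    calc dq n ^ 4 = (dq n * dq n) * (dq n * dq n) := by ring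
      _ ≤ Nat.sqrt n * Nat.sqrt n := Nat.mul_le_mul h1 h1
      _ ≤ n := Nat.sqrt_le n
  have h1 : (dq n - 1) ^ 4 + dq n ≤ dq n ^ 4 := pred_pow_four_add_le hD
  have h2 : (dq n - 1) ^ 4 ≤ m := by omega
  show dq n - 1 ≤ Nat.sqrt (Nat.sqrt m)
  rw [Nat.le_sqrt, Nat.le_sqrt]
  calc (dq n - 1) * (dq n - 1) * ((dq n - 1) * (dq n - 1)) = (dq n - 1) ^ 4 := by ring
    _ ≤ m := h2

/-- **The spread-cell bound in the reduced instances, complement-symmetric form (mod KL).** See the module docstring.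
[cite: KeevashLifshitz2023, Thm. 1.8] [cite: Rothvoss2017, §2 (PDF pp. 5–6)] -/
theorem reduced_spreadCell_value_le_of_globalLevelD (hKL : GlobalLevelDInequality) :
    ∃ c₀ : ℝ, 0 < c₀ ∧ c₀ ≤ 1 ∧ ∃ n₀ : ℕ, ∀ (n q Dg T : ℕ) (Bv : ℝ) (C : Finset ℕ),
      (∀ c ∈ C, Odd c ∧ 3 ≤ c ∧ c ≤ T) → T * T ≤ 49 * n → 200 * T ≤ n → 40 * q ≤ n → 2 * q ≤ dq n → Dg ≤ dq n → 1 ≤ dq n →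
      4 * dq n + 8 ≤ n →
      ∀ (m t'' D' : ℕ) (w' : ℕ → ℝ), n₀ ≤ m → n ≤ m + 2 * q → Even m → Odd t'' → m ≤ 5 * t'' → m ≤ 5 * (m - t'') →
      T ≤ t'' → T ≤ m - t'' → D' + 3 ≤ t'' → D' + 3 ≤ m - t'' → Dg ≤ D' + q → D' ≤ Dg →
      (∀ c ∈ C, (Qset m t'' c).Nonempty) →
      (∀ p : Polynomial ℝ, p.natDegree ≤ D' → ∑ c ∈ C, w' c * p.eval (c : ℝ) = -p.eval 0) →
      ∑ c ∈ C, |w' c| ≤ Bv →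
      ∀ (X : Finset (OddSet m)), (∀ U ∈ X, U.1.card = t'') →
      ∀ (Y' : Finset (PMatch m)), IsRelHomogeneous (Real.exp 1) (perfectMatchings (univ : Finset (Fin m))) (Y'.image Subtype.val) →
      Real.exp (-(c₀ * dq m)) ≤ (X.card : ℝ) / (m.choose t'' : ℝ) →
      Real.exp (-(c₀ * dq m)) ≤ (Y'.card : ℝ) / (Fintype.card (PMatch m) : ℝ) →
      ∑ U ∈ X, ∑ M ∈ Y', levelWeight m t'' C w' U M ≤
        Bv * (Real.exp 2000 * Real.sqrt (∏ i ∈ range ((Dg - q) / 2 + 1), ((2 * i + 1 : ℝ) / ((n : ℝ) - 2 * q - 2 * i)))) := by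
  have hτ : (1 : ℝ) ≤ Real.exp 1 := by have := Real.add_one_le_exp (1 : ℝ); linarith
  obtain ⟨c₀, hc₀, hc₀1, n₀, hhalf⟩ := spreadCell_value_le_half_of_globalLevelD hKL hτ
  refine ⟨c₀, hc₀, hc₀1, max n₀ 400, ?_⟩
  intro n q Dg T Bv C hC hT49 hT200 hq40 h2q hDgn hD1 hdqn m t'' D' w' hm₀ hmq hmeven htodd h5 h5' hTt hTt' hD3 hD3' hDgD' hD'Dg
    hQ hexact hvar X hX Y' hhom hμ hν
  have hn₀m : n₀ ≤ m := le_trans (le_max_left _ _) hm₀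
  have hm400 : 400 ≤ m := le_trans (le_max_right _ _) hm₀
  have hBv : 0 ≤ Bv := (sum_nonneg fun c _ => abs_nonneg (w' c)).trans hvar
  set Pstar : ℝ := ∏ i ∈ range ((Dg - q) / 2 + 1), ((2 * i + 1 : ℝ) / ((n : ℝ) - 2 * q - 2 * i)) with hPstar
  have hΓ0 : (0 : ℝ) ≤ Real.exp 2000 := (Real.exp_pos _).le
  -- `D' ≤ 2(dq m + 8)`
  have hDqm : D' ≤ 2 * (dq m + 8) := by
    have := dq_pred_le (n := n) hmq h2q hD1
    omega
  -- numeric facts used by the attenuation-factor bound for both cut sizes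
  have hT2m : T * T ≤ 100 * m := by nlinarith
  have hTm : 200 * T ≤ 2 * m + 2 * q := by omega
  -- the reduced tail is below `P*`
  have hPle : Real.sqrt (∏ i ∈ range (D' / 2 + 1), ((2 * i + 1 : ℝ) / ((m : ℝ) - 2 * i))) ≤ Real.sqrt Pstar :=
    Real.sqrt_le_sqrt (prod_atten_reduced_le (n := n) hmq (by omega) (by omega) (by omega))
  -- densities are at most one
  have hPMm : (0 : ℝ) < Fintype.card (PMatch m) := by exact_mod_cast card_pmatch_pos hmeven
  have hν1 : (Y'.card : ℝ) / (Fintype.card (PMatch m) : ℝ) ≤ 1 := by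
    rw [div_le_one hPMm]; exact_mod_cast (card_le_univ Y').trans_eq Finset.card_univ
  -- the common final step
  have hfinish : ∀ (t₀ : ℕ) (X₀ : Finset (OddSet m)), Odd t₀ → (∀ U ∈ X₀, U.1.card = t₀) →
      ∑ U ∈ X₀, ∑ M ∈ Y', levelWeight m t₀ C w' U M ≤
        Bv * Real.exp 2000 * Real.sqrt ((∏ i ∈ range (D' / 2 + 1), ((2 * i + 1 : ℝ) / ((m : ℝ) - 2 * i))) *
          ((X₀.card : ℝ) / (m.choose t₀ : ℝ)) * ((Y'.card : ℝ) / (Fintype.card (PMatch m) : ℝ))) →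
      ∑ U ∈ X₀, ∑ M ∈ Y', levelWeight m t₀ C w' U M ≤ Bv * (Real.exp 2000 * Real.sqrt Pstar) := by
    intro t₀ X₀ ht₀ hX₀ hle
    have hP0 : 0 ≤ ∏ i ∈ range (D' / 2 + 1), ((2 * i + 1 : ℝ) / ((m : ℝ) - 2 * i)) :=
      prod_nonneg fun i hi => (atten_factor_le_one (n := m) (by have := mem_range.1 hi; omega)).1
    have hμ1 : (X₀.card : ℝ) / (m.choose t₀ : ℝ) ≤ 1 := by
      rcases Nat.eq_zero_or_pos (m.choose t₀) with h0 | hpos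
      · rw [h0]; simp
      · rw [div_le_one (by exact_mod_cast hpos), ← card_tcuts_eq_choose (n := m) ht₀]
        exact_mod_cast card_le_card fun U hU => by rw [mem_filter]; exact ⟨mem_univ _, hX₀ U hU⟩
    have hsq : Real.sqrt ((∏ i ∈ range (D' / 2 + 1), ((2 * i + 1 : ℝ) / ((m : ℝ) - 2 * i))) *
          ((X₀.card : ℝ) / (m.choose t₀ : ℝ)) * ((Y'.card : ℝ) / (Fintype.card (PMatch m) : ℝ))) ≤ Real.sqrt Pstar := by
      refine (Real.sqrt_le_sqrt ?_).trans hPle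
      calc _ ≤ (∏ i ∈ range (D' / 2 + 1), ((2 * i + 1 : ℝ) / ((m : ℝ) - 2 * i))) * (1 * 1) := by
            rw [mul_assoc]
            exact mul_le_mul_of_nonneg_left (mul_le_mul hμ1 hν1 (by positivity) zero_le_one) hP0
        _ = _ := by ring
    calc _ ≤ _ := hle
      _ ≤ Bv * Real.exp 2000 * Real.sqrt Pstar := mul_le_mul_of_nonneg_left hsq (mul_nonneg hBv hΓ0)
      _ = Bv * (Real.exp 2000 * Real.sqrt Pstar) := by ring
  by_cases h2t : 2 * t'' ≤ m
  · -- direct case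
    obtain ⟨c'', hc''⟩ := htodd
    subst hc''
    refine hfinish _ X ⟨c'', rfl⟩ hX (hhalf m c'' T D' Bv (Real.exp 2000) C w' hn₀m hmeven h2t h5 hTt (by omega) hDqm
      (fun c hc => ⟨(hC c hc).1, (hC c hc).2.1, (hC c hc).2.2, hQ c hc⟩) hexact hvar hΓ0 (fun m₁ hm₁ => ?_) X hX Y' hhom hμ hν)
    exact levelFactor_pow_le_exp hm₁ (by omega) (by omega) hT2m (by omega)
  · -- complement case: cut size `m − t'' = 2c₃ + 1 < m/2`
    push Not at h2t
    have htm : t'' ≤ m := by omega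
    obtain ⟨k, hk⟩ := hmeven
    obtain ⟨c₂, hc₂⟩ := htodd
    obtain ⟨c₃, hc₃⟩ : ∃ c₃, m - t'' = 2 * c₃ + 1 := ⟨(m - t'') / 2, by omega⟩
    have hmeven' : Even m := ⟨k, hk⟩
    obtain ⟨hval, hcard⟩ := sum_levelWeight_compl hmeven' htm C w' X Y'
    rw [← hval]
    set X' := X.image (fun U : OddSet m => (⟨univ \ U.1, odd_card_compl hmeven' U⟩ : OddSet m)) with hX'def
    have hX' : ∀ U ∈ X', U.1.card = 2 * c₃ + 1 := by
      intro U hU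
      obtain ⟨U₀, hU₀, rfl⟩ := mem_image.1 hU
      simp only [card_univ_sdiff, Fintype.card_fin, hX U₀ hU₀]
      omega
    have hμ' : Real.exp (-(c₀ * dq m)) ≤ (X'.card : ℝ) / (m.choose (2 * c₃ + 1) : ℝ) := by
      rw [hcard, ← hc₃, Nat.choose_symm htm]; exact hμ
    have hQ' : ∀ c ∈ C, (Qset m (2 * c₃ + 1) c).Nonempty := by
      intro c hc
      rw [← hc₃, ← card_pos, card_Qset_compl hmeven' htm, card_pos]
      exact hQ c hc
    rw [hc₃]
    refine hfinish _ X' ⟨c₃, rfl⟩ hX' (hhalf m c₃ T D' Bv (Real.exp 2000) C w' hn₀m hmeven' (by omega) (by omega) (by omega) (by omega) hDqm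
      (fun c hc => ⟨(hC c hc).1, (hC c hc).2.1, (hC c hc).2.2, hQ' c hc⟩) hexact hvar hΓ0 (fun m₁ hm₁ => ?_) X' hX' Y' hhom hμ' hν)
    exact levelFactor_pow_le_exp hm₁ (by omega) (by omega) hT2m (by omega)

end Summit.PneNP.PneNP.Theorems.ChebyshevTracialDesignReducedSpreadCell
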